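import Literature.NumberTheory.LFunctions.TruncatedWeilFormTailOrder
import Literature.LinearAlgebra.Matrix.CauchyDeterminant
import Literature.LinearAlgebra.Matrix.SylvesterCriterion
import Literature.Barriers.AtomisticToContinuum.OneDimensionalHardCoreProofs

/-!
# RH-FREE — «nothing here bears on the truth of RH»: strict total positivity of the archimedean tail increment (Groskin 2026, arXiv:2607.02828v3, Theorem 3.2, minors clause), PROVED

PROOF LAYER (theorems only, no new definitions, no named facts) for the statement file
`Literature/NumberTheory/LFunctions/TruncatedWeilFormTailOrder.lean` ([Gr26] = Groskin,
arXiv:2607.02828v3, unrefereed; D-0012: a kernel proof VERIFIES a printed finite statement, it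
asserts nothing on authority).

## What is proved

[Gr26] Theorem 3.2 (p. 10; TeX source `main.tex` ll. 729–746, proof ll. 748–841) has three clauses:
(1) the rank-two density representation of `Δ_{T₁,T₂} = Q_arch,T₂ − Q_arch,T₁`, (2) positive
definiteness, (3) strict positivity of every minor with increasing row and column sets. This file
proves **clause (3) for the explicit rank-two density matrix**

  `M(m,n) = (1/π²) ∫_{T₁}^{T₂} h₊(T) sin²(LT/2) ρ⁻¹ (p_T(m) p_T(n) + q_T(m) q_T(n)) dT`

(the literal right-hand side of clause (1) as typed in `Groskin2026.theorem_3_2`), following the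
printed proof (ll. 800–841): after the reflection `T ↦ −T` on the `q`-part (evenness of
`h₊(T) sin²(LT/2)`), `M(m,n) = ∫_S W(s) ds/((s − ρm)(s − ρn))` over `S = [−T₂,−T₁] ∪ [T₁,T₂]` with the
non-negative continuous weight `W(s) = ρ h₊(s) sin²(Ls/2)/π²`; Andréief's identity (the tree's
`Literature.Barriers.AtomisticToContinuum.BoseGas.integral_det_mul_det`, a GENERIC continuous
Cauchy–Binet formula reused by name) writes `k! · det[M(x_i,y_j)]` as the integral over `S^k` of
`(∏_r W(s_r)) · det[1/(s_r − ρx_t)] · det[1/(s_r − ρy_t)]`, and Cauchy's double alternant (the tree's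
`Literature.LinearAlgebra.Matrix.det_cauchyMatrix`) shows that the product of the two Cauchy
determinants is `[∏_{r<r'}(s_{r'} − s_r)]² ∏_{i<j}(x_i − x_j)(y_i − y_j) / ∏_{r,t}(s_r − ρx_t)(s_r − ρy_t)`,
non-negative because the nodes are increasing and every `|s_r| > ρN` exceeds every `|ρ x_t|`, and
positive on an open box of distinct coordinates inside `(T₁,T₂)^k` where `sin(Ls/2) ≠ 0`; hence the
integral, and the minor, is `> 0`.

The two ingredients are isolated as reusable theorems: `det_cauchyMatrix_mul_det_cauchyMatrix_eq`
(`_nonneg`, `_pos`: the product of two Cauchy determinants with a common row variable is a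
quotient of manifestly signed products) and `det_setIntegral_cauchyKernel_pos` (every minor of
`(t,t') ↦ ∫_S W(s) ds/((s − u_t)(s − v_{t'}))` is `> 0` for a compact `S` separated from the
increasing nodes and a weight `W ≥ 0` positive on a subinterval).  Clause (2) (positive
definiteness) then follows from clause (3) by Sylvester's criterion (the tree's
`Literature.LinearAlgebra.Matrix.posDef_of_leadingMinors_pos`, after re-indexing `I_N` increasingly:
`posDef_of_det_submatrix_pos`).  The glue theorems `theorem_3_2_of_repr_of_posDef` (from clauses
(1)–(2)) and `theorem_3_2_of_repr` (from clause (1) ALONE) reduce the typed claim `theorem_3_2` to its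
representation clause (1), which is not proved in this file; the discharge `theorem_3_2_holds` is the
one-liner `theorem_3_2_of_repr c1` once clause (1) is a tree theorem.

LABEL: RH-FREE literature (Cauchy-kernel total positivity of a finite Stieltjes integral at fixed
`(c, N)`); bears_on: W-C/W-P (COLUMN 2 WEIL). WHAT THIS IS NOT: any claim about `ζ`, Weil
positivity or RH — "the paper does not prove RH, Weil positivity, a prime-location bound" ([Gr26]
p. 13), and a kernel replay of its Theorem 3.2 moves nothing. Nothing here bears on the truth of RH.

## References

* [Gr26] A. Groskin, *A finite Guinand–Weil dictionary and archimedean tail order for the truncated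
  Weil quadratic form*, arXiv:2607.02828v3 (2026), §3, Theorem 3.2 and its proof (Andréief's
  identity, Cauchy's determinant; Karlin, *Total positivity* I (1968), Ch. 1).
-/

noncomputable section

open MeasureTheory Set Filter Finset Matrix Real
open scoped Real Topology BigOperators

namespace Literature.NumberTheory.LFunctions.Groskin2026

open Literature.Analysis.SpecialFunctions Literature.LinearAlgebra.Matrix
  Literature.Barriers.AtomisticToContinuum.BoseGas

/-! ## §1. The sign of a product of two Cauchy determinants with a common row variable -/

/-- For sequences `x`, `u`, `v` with `u`, `v` co-monotone (`(u_i − u_j)(v_i − v_j) > 0`, `i < j < k`)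
and every `x_i` on the same side of `u_j` and `v_j` (`(x_i − u_j)(x_i − v_j) > 0`), the product of
the Cauchy determinants `det[1/(x_i − u_j)] · det[1/(x_i − v_j)]` is
`(∏_{i<j} (x_j − x_i)² (u_i − u_j)(v_i − v_j)) / ∏_{i,j} (x_i − u_j)(x_i − v_j)`.
[cite: Groskin2026, Theorem 3.2, proof (p. 10–11; Cauchy determinant step)] -/
theorem det_cauchyMatrix_mul_det_cauchyMatrix_eq (x u v : ℕ → ℝ) (k : ℕ)
    (hsep : ∀ i j : ℕ, i < k → j < k → 0 < (x i - u j) * (x i - v j)) :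
    (cauchyMatrix x u k).det * (cauchyMatrix x v k).det =
      (∏ j ∈ range k, ∏ i ∈ range j, ((x j - x i) ^ 2 * ((u i - u j) * (v i - v j)))) /
        ∏ i ∈ range k, ∏ j ∈ range k, ((x i - u j) * (x i - v j)) := by
  have hxu : ∀ i j : ℕ, i < k → j < k → x i ≠ u j := fun i j hi hj h ↦ by
    have := hsep i j hi hj; rw [h, sub_self, zero_mul] at this; exact lt_irrefl _ this
  have hxv : ∀ i j : ℕ, i < k → j < k → x i ≠ v j := fun i j hi hj h ↦ by
    have := hsep i j hi hj; rw [h, sub_self, mul_zero] at this; exact lt_irrefl _ this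
  rw [det_cauchyMatrix x u k hxu, det_cauchyMatrix x v k hxv, div_mul_div_comm,
    ← Finset.prod_mul_distrib, ← Finset.prod_mul_distrib]
  congr 1
  · refine Finset.prod_congr rfl fun j _ ↦ ?_
    rw [← Finset.prod_mul_distrib]
    refine Finset.prod_congr rfl fun i _ ↦ ?_
    ring
  · refine Finset.prod_congr rfl fun i _ ↦ ?_
    rw [← Finset.prod_mul_distrib]

/-- Under the hypotheses of `det_cauchyMatrix_mul_det_cauchyMatrix_eq` the product of the two Cauchy
determinants is non-negative. [cite: Groskin2026, Theorem 3.2, proof (p. 11: "the two signs cancel and the integrand is nonnegative")] -/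
theorem det_cauchyMatrix_mul_det_cauchyMatrix_nonneg (x u v : ℕ → ℝ) (k : ℕ)
    (huv : ∀ i j : ℕ, i < j → j < k → 0 < (u i - u j) * (v i - v j))
    (hsep : ∀ i j : ℕ, i < k → j < k → 0 < (x i - u j) * (x i - v j)) :
    0 ≤ (cauchyMatrix x u k).det * (cauchyMatrix x v k).det := by
  rw [det_cauchyMatrix_mul_det_cauchyMatrix_eq x u v k hsep]
  refine div_nonneg (Finset.prod_nonneg fun j hj ↦ Finset.prod_nonneg fun i hi ↦ ?_)
    (Finset.prod_nonneg fun i hi ↦ Finset.prod_nonneg fun j hj ↦ ?_)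
  · rw [Finset.mem_range] at hi hj
    exact mul_nonneg (sq_nonneg _) (huv i j hi hj).le
  · rw [Finset.mem_range] at hi hj
    exact (hsep i j hi hj).le

/-- Under the hypotheses of `det_cauchyMatrix_mul_det_cauchyMatrix_eq` and for pairwise distinct
`x_i` (`i < k`) the product of the two Cauchy determinants is strictly positive.
[cite: Groskin2026, Theorem 3.2, proof (p. 11: "positive on a set of positive measure")] -/
theorem det_cauchyMatrix_mul_det_cauchyMatrix_pos (x u v : ℕ → ℝ) (k : ℕ)
    (huv : ∀ i j : ℕ, i < j → j < k → 0 < (u i - u j) * (v i - v j))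
    (hsep : ∀ i j : ℕ, i < k → j < k → 0 < (x i - u j) * (x i - v j))
    (hx : ∀ i j : ℕ, i < j → j < k → x i ≠ x j) :
    0 < (cauchyMatrix x u k).det * (cauchyMatrix x v k).det := by
  rw [det_cauchyMatrix_mul_det_cauchyMatrix_eq x u v k hsep]
  refine div_pos (Finset.prod_pos fun j hj ↦ Finset.prod_pos fun i hi ↦ ?_)
    (Finset.prod_pos fun i hi ↦ Finset.prod_pos fun j hj ↦ ?_)
  · rw [Finset.mem_range] at hi hj
    exact mul_pos (sq_pos_of_ne_zero (sub_ne_zero.2 (hx i j hi hj).symm)) (huv i j hi hj)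
  · rw [Finset.mem_range] at hi hj
    exact hsep i j hi hj

/-! ## §2. Andréief's identity + Cauchy: positivity of the minors of a two-sided Stieltjes–Cauchy kernel -/

/-- Bridge from the matrix `((X_r − u_t)⁻¹)_{r,t}` indexed by `Fin k` to the tree's `cauchyMatrix`
(sequences indexed by `ℕ`, extended by `0`). [folklore] -/
private theorem det_of_inv_sub_eq_det_cauchyMatrix {k : ℕ} (X u : Fin k → ℝ) :
    det (of fun r t : Fin k => (X r - u t)⁻¹) =
      (cauchyMatrix (fun i => if h : i < k then X ⟨i, h⟩ else 0)
        (fun i => if h : i < k then u ⟨i, h⟩ else 0) k).det := by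
  congr 1
  ext r t
  simp [cauchyMatrix_apply, r.2, t.2]

/-- **Strict positivity of Cauchy–Stieltjes minors** (the mechanism of [Gr26] Thm 3.2, clause 3,
isolated): let `S ⊂ ℝ` be compact, `W ≥ 0` continuous on `S` and `> 0` on a non-degenerate interval
`[α, β] ⊆ S`, and let `u, v : Fin k → ℝ` be strictly increasing nodes such that every `s ∈ S` lies on
the same side of all of them (`(s − u_t)(s − v_{t'}) > 0`). Then
`det [∫_S W(s) ds / ((s − u_t)(s − v_{t'}))]_{t,t'} > 0`.  Proof as printed: Andréief's identity
(`integral_det_mul_det`) and the sign of the product of two Cauchy determinants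
(`det_cauchyMatrix_mul_det_cauchyMatrix_nonneg/_pos`), the integrand being positive on a box of
distinct coordinates inside `(α, β)^k`.
[cite: Groskin2026, Theorem 3.2, proof (pp. 10–11: Andréief identity, Cauchy determinant, "the integral is therefore strictly positive")] -/
theorem det_setIntegral_cauchyKernel_pos {k : ℕ} {S : Set ℝ} (hS : IsCompact S)
    {W : ℝ → ℝ} (hW : ContinuousOn W S) (hW0 : ∀ s ∈ S, 0 ≤ W s)
    (u v : Fin k → ℝ) (hu : StrictMono u) (hv : StrictMono v)
    (hsep : ∀ s ∈ S, ∀ t t' : Fin k, 0 < (s - u t) * (s - v t'))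
    {α β : ℝ} (hαβ : α < β) (hJ : Set.Icc α β ⊆ S) (hWJ : ∀ s ∈ Set.Icc α β, 0 < W s) :
    0 < det (of fun t t' : Fin k => ∫ s in S, W s / ((s - u t) * (s - v t'))) := by
  classical
  set μ : Measure ℝ := volume.restrict S with hμ
  set F : Fin k → ℝ → ℝ := fun t s => W s * (s - u t)⁻¹ with hF
  set G : Fin k → ℝ → ℝ := fun t s => (s - v t)⁻¹ with hG
  have hne_u : ∀ s ∈ S, ∀ t : Fin k, s - u t ≠ 0 := by
    intro s hs t h
    have := hsep s hs t t; rw [h, zero_mul] at this; exact lt_irrefl _ this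
  have hne_v : ∀ s ∈ S, ∀ t : Fin k, s - v t ≠ 0 := by
    intro s hs t h
    have := hsep s hs t t; rw [h, mul_zero] at this; exact lt_irrefl _ this
  -- integrability of the kernel entries on the compact `S`
  have hFG : ∀ t t', Integrable (fun s => F t s * G t' s) μ := by
    intro t t'
    have hcont : ContinuousOn (fun s => F t s * G t' s) S :=
      (hW.mul (ContinuousOn.inv₀ (by fun_prop) fun s hs => hne_u s hs t)).mul
        (ContinuousOn.inv₀ (by fun_prop) fun s hs => hne_v s hs t')
    exact hcont.integrableOn_compact hS
  -- the entries are `∫ F_t G_{t'} dμ`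
  have hentry : (of fun t t' : Fin k => ∫ s in S, W s / ((s - u t) * (s - v t'))) =
      of fun t t' => ∫ s, F t s * G t' s ∂μ := by
    ext t t'
    simp only [of_apply, hF, hG, hμ]
    refine integral_congr_ae (ae_of_all _ fun s => ?_)
    simp only [div_eq_mul_inv, mul_inv, mul_assoc]
  rw [hentry]
  -- Andréief
  have hA := integral_det_mul_det (𝕜 := ℝ) μ F G hFG
  have hint := integrable_det_mul_det (𝕜 := ℝ) μ F G hFG
  have hfac : (0 : ℝ) < (k.factorial : ℝ) := by exact_mod_cast Nat.factorial_pos k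
  suffices hP : 0 < ∫ X : Fin k → ℝ, det (of fun r t => F t (X r)) * det (of fun r t => G t (X r))
      ∂(Measure.pi fun _ => μ) by
    rw [hA] at hP
    exact (mul_pos_iff_of_pos_left hfac).mp hP
  -- extended sequences for the Cauchy determinant
  set ue : ℕ → ℝ := fun i => if h : i < k then u ⟨i, h⟩ else 0 with hue
  set ve : ℕ → ℝ := fun i => if h : i < k then v ⟨i, h⟩ else 0 with hve
  have huv' : ∀ i j : ℕ, i < j → j < k → 0 < (ue i - ue j) * (ve i - ve j) := by
    intro i j hij hjk
    have hik : i < k := hij.trans hjk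
    simp only [hue, hve, dif_pos hik, dif_pos hjk]
    have h1 : u ⟨i, hik⟩ < u ⟨j, hjk⟩ := hu (Fin.mk_lt_mk.2 hij)
    have h2 : v ⟨i, hik⟩ < v ⟨j, hjk⟩ := hv (Fin.mk_lt_mk.2 hij)
    nlinarith
  -- pointwise closed form of the integrand on `S^k`
  have hPdef : ∀ X : Fin k → ℝ, (∀ r, X r ∈ S) →
      det (of fun r t => F t (X r)) * det (of fun r t => G t (X r)) =
        (∏ r, W (X r)) *
          ((cauchyMatrix (fun i => if h : i < k then X ⟨i, h⟩ else 0) ue k).det *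
            (cauchyMatrix (fun i => if h : i < k then X ⟨i, h⟩ else 0) ve k).det) := by
    intro X _
    have h1 : (of fun r t => F t (X r)) =
        of fun i j => (fun r => W (X r)) i * (of fun r t : Fin k => (X r - u t)⁻¹) i j := by
      ext i j; simp [hF]
    have h2 : (of fun r t => G t (X r)) = of fun r t : Fin k => (X r - v t)⁻¹ := by
      ext i j; simp [hG]
    rw [h1, det_mul_column, h2, det_of_inv_sub_eq_det_cauchyMatrix,
      det_of_inv_sub_eq_det_cauchyMatrix, mul_assoc]
  have hsep' : ∀ X : Fin k → ℝ, (∀ r, X r ∈ S) → ∀ i j : ℕ, i < k → j < k →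
      0 < ((fun i => if h : i < k then X ⟨i, h⟩ else 0) i - ue j) *
        ((fun i => if h : i < k then X ⟨i, h⟩ else 0) i - ve j) := by
    intro X hX i j hi hj
    simp only [hue, hve, dif_pos hi, dif_pos hj]
    exact hsep _ (hX _) _ _
  -- the integration variables lie in `S^k` almost everywhere
  have hpi : (Measure.pi fun _ : Fin k => μ) =
      (volume : Measure (Fin k → ℝ)).restrict (Set.univ.pi fun _ => S) := by
    rw [hμ, volume_pi, ← Measure.restrict_pi_pi]
  have hae : ∀ᵐ X ∂(Measure.pi fun _ : Fin k => μ), ∀ r, X r ∈ S := by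
    rw [hpi]
    filter_upwards [ae_restrict_mem (MeasurableSet.univ_pi fun _ => hS.measurableSet)] with X hX
    exact fun r => hX r (Set.mem_univ _)
  have hnonneg : 0 ≤ᵐ[Measure.pi fun _ : Fin k => μ]
      fun X => det (of fun r t => F t (X r)) * det (of fun r t => G t (X r)) := by
    filter_upwards [hae] with X hX
    simp only [Pi.zero_apply]
    rw [hPdef X hX]
    exact mul_nonneg (Finset.prod_nonneg fun r _ => hW0 _ (hX r))
      (det_cauchyMatrix_mul_det_cauchyMatrix_nonneg _ _ _ k huv' (hsep' X hX))
  rw [integral_pos_iff_support_of_nonneg_ae hnonneg hint]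
  -- a box of distinct coordinates inside `(α, β)^k`
  set a : Fin k → ℝ := fun r => α + (β - α) * (2 * (r : ℝ) + 1) / (2 * k + 2) with ha
  set b : Fin k → ℝ := fun r => α + (β - α) * (2 * (r : ℝ) + 2) / (2 * k + 2) with hb
  have hk2 : (0 : ℝ) < 2 * k + 2 := by positivity
  have hab : ∀ r, a r < b r := by
    intro r; simp only [ha, hb]
    have : (β - α) * (2 * (r : ℝ) + 1) / (2 * k + 2) < (β - α) * (2 * (r : ℝ) + 2) / (2 * k + 2) :=
      div_lt_div_of_pos_right (by nlinarith) hk2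
    linarith
  have hαa : ∀ r, α ≤ a r := by
    intro r; simp only [ha]
    have : 0 ≤ (β - α) * (2 * (r : ℝ) + 1) / (2 * k + 2) := by
      have : 0 ≤ β - α := by linarith
      positivity
    linarith
  have hbβ : ∀ r : Fin k, b r ≤ β := by
    intro r; simp only [hb]
    have hr : (r : ℝ) + 1 ≤ k := by exact_mod_cast Nat.succ_le_of_lt r.2
    have : (β - α) * (2 * (r : ℝ) + 2) / (2 * k + 2) ≤ (β - α) := by
      rw [div_le_iff₀ hk2]; nlinarith
    linarith
  have hba : ∀ r r' : Fin k, r < r' → b r ≤ a r' := by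
    intro r r' hrr'
    simp only [ha, hb]
    have h : (r : ℝ) + 1 ≤ r' := by exact_mod_cast Nat.succ_le_of_lt (Fin.lt_def.1 hrr')
    have : (β - α) * (2 * (r : ℝ) + 2) / (2 * k + 2) ≤ (β - α) * (2 * (r' : ℝ) + 1) / (2 * k + 2) :=
      div_le_div_of_nonneg_right (by nlinarith) hk2.le
    linarith
  set B : Set (Fin k → ℝ) := Set.univ.pi fun r => Set.Ioo (a r) (b r) with hB
  have hBS : ∀ X ∈ B, ∀ r, X r ∈ Set.Icc α β := by
    intro X hX r
    have h := hX r (Set.mem_univ _)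
    exact ⟨(hαa r).trans h.1.le, h.2.le.trans (hbβ r)⟩
  have hBsupp : B ⊆ Function.support
      fun X => det (of fun r t => F t (X r)) * det (of fun r t => G t (X r)) := by
    intro X hX
    have hXS : ∀ r, X r ∈ S := fun r => hJ (hBS X hX r)
    rw [Function.mem_support, hPdef X hXS]
    refine (mul_pos (Finset.prod_pos fun r _ => hWJ _ (hBS X hX r)) ?_).ne'
    refine det_cauchyMatrix_mul_det_cauchyMatrix_pos _ _ _ k huv' (hsep' X hXS) fun i j hij hjk => ?_
    have hik : i < k := hij.trans hjk
    simp only [dif_pos hik, dif_pos hjk]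
    have h1 := (hX ⟨i, hik⟩ (Set.mem_univ _)).2
    have h2 := (hX ⟨j, hjk⟩ (Set.mem_univ _)).1
    have h3 := hba ⟨i, hik⟩ ⟨j, hjk⟩ (Fin.mk_lt_mk.2 hij)
    exact ne_of_lt (h1.trans_le (h3.trans h2.le))
  refine lt_of_lt_of_le ?_ (measure_mono hBsupp)
  rw [hB, Measure.pi_pi]
  refine pos_iff_ne_zero.2 (Finset.prod_ne_zero_iff.2 fun r _ => ?_)
  rw [hμ, Measure.restrict_apply measurableSet_Ioo,
    Set.inter_eq_left.2 ((Set.Ioo_subset_Icc_self.trans (Set.Icc_subset_Icc (hαa r) (hbβ r))).trans hJ),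
    Real.volume_Ioo]
  exact (ENNReal.ofReal_pos.2 (by linarith [hab r])).ne'

/-! ## §3. The rank-two density as a two-sided Stieltjes–Cauchy kernel -/

/-- `ρ = 2π/log c > 0` for `c > 1`. [cite: Groskin2026, §2.1 (p. 3)] -/
theorem rho_pos {c : ℝ} (hc : 1 < c) : 0 < rho c := by
  unfold rho
  exact div_pos (by positivity) (Real.log_pos hc)

/-- `L·s/2 = π s/ρ` (`L = log c`, `ρ = 2π/L`). [cite: Groskin2026, §2.1 (p. 3)] -/
theorem log_mul_div_two_eq {c : ℝ} (hc : 1 < c) (s : ℝ) :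
    Real.log c * s / 2 = π * s / rho c := by
  unfold rho
  have hL : Real.log c ≠ 0 := (Real.log_pos hc).ne'
  field_simp

/-- `p_T(m) = ρ/(T − ρ m)`. [cite: Groskin2026, §3 (p. 8)] -/
theorem pVec_eq {c : ℝ} (hc : 1 < c) (N : ℕ) (T : ℝ) (m : idx N) :
    pVec c N T m = rho c / (T - rho c * ((m : ℤ) : ℝ)) := by
  have hρ : rho c ≠ 0 := (rho_pos hc).ne'
  unfold pVec aCut
  rw [show T / rho c - ((m : ℤ) : ℝ) = (T - rho c * ((m : ℤ) : ℝ)) / rho c by field_simp,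
    one_div_div]

/-- `q_T(m) = ρ/(T + ρ m)`. [cite: Groskin2026, §3 (p. 8)] -/
theorem qVec_eq {c : ℝ} (hc : 1 < c) (N : ℕ) (T : ℝ) (m : idx N) :
    qVec c N T m = rho c / (T + rho c * ((m : ℤ) : ℝ)) := by
  have hρ : rho c ≠ 0 := (rho_pos hc).ne'
  unfold qVec aCut
  rw [show T / rho c + ((m : ℤ) : ℝ) = (T + rho c * ((m : ℤ) : ℝ)) / rho c by field_simp,
    one_div_div]

/-- Nodes are small: `|ρ m| ≤ ρ N` for `m ∈ I_N`. [cite: Groskin2026, §3 (p. 8)] -/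
theorem abs_rho_mul_le {c : ℝ} (hc : 1 < c) {N : ℕ} (m : idx N) :
    |rho c * ((m : ℤ) : ℝ)| ≤ rho c * N := by
  have h := natAbs_le_of_mem_idx m.2
  have h1 : |(m : ℤ)| ≤ (N : ℤ) := by rw [Int.abs_eq_natAbs]; exact_mod_cast h
  have h2 : |((m : ℤ) : ℝ)| ≤ N := by exact_mod_cast h1
  rw [abs_mul, abs_of_pos (rho_pos hc)]
  exact mul_le_mul_of_nonneg_left h2 (rho_pos hc).le

/-- `h₊` is even (from `reDigammaQuarter_even`). [cite: Groskin2026, §2.1 (p. 4)] -/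
theorem hPlus_neg (r : ℝ) : hPlus (-r) = hPlus r := by
  unfold hPlus; rw [reDigammaQuarter_even]

/-- `h₊` is continuous (from `continuous_reDigammaQuarter`). [cite: Groskin2026, §2.1 (p. 4)] -/
theorem continuous_hPlus : Continuous hPlus := by
  unfold hPlus; exact continuous_reDigammaQuarter.sub continuous_const

/-- `h₊ > 0` on `|r| ≥ 7`. [cite: Groskin2026, Lemma 3.1 (p. 9)] -/
theorem hPlus_pos_of_seven_le_abs {r : ℝ} (hr : 7 ≤ |r|) : 0 < hPlus r := by
  rcases le_or_gt 0 r with h | h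
  · exact hPlus_pos_of_seven_le (by rwa [abs_of_nonneg h] at hr)
  · rw [← hPlus_neg]; exact hPlus_pos_of_seven_le (by rwa [abs_of_neg h] at hr)

/-- **The rank-two density entry as a two-sided Cauchy–Stieltjes integral** ([Gr26] Thm 3.2,
proof, "after the change of variables … the same representation is
`Δ(m,n) = ∫_{[−B,−A]∪[A,B]} dν(s)/((s−m)(s−n))`", here kept in the variable `T = ρa`): for
`T₁ > ρN`, `T₁ > 0`, `T₁ < T₂` and `m, n ∈ I_N`,
`(1/π²)∫_{T₁}^{T₂} h₊(T) sin²(LT/2) ρ⁻¹ (p_T(m)p_T(n) + q_T(m)q_T(n)) dT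
  = ∫_{[−T₂,−T₁]∪[T₁,T₂]} W(s) ds/((s − ρm)(s − ρn))`, `W(s) = ρ h₊(s) sin²(Ls/2)/π²`
(reflection `T ↦ −T` on the `q`-part, evenness of `h₊` and `sin²`).
[cite: Groskin2026, Theorem 3.2, proof (p. 11, change of variables and push-forward to `s = ±a`)] -/
theorem tailDensity_entry_eq_setIntegral {c : ℝ} (hc : 1 < c) (N : ℕ) {T₁ T₂ : ℝ}
    (hN : rho c * N < T₁) (h0 : 0 < T₁) (h12 : T₁ < T₂) (m n : idx N) :
    (1 / π ^ 2) * ∫ T in T₁..T₂, hPlus T * Real.sin (Real.log c * T / 2) ^ 2 / rho c *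
        (pVec c N T m * pVec c N T n + qVec c N T m * qVec c N T n) =
      ∫ s in Set.Icc (-T₂) (-T₁) ∪ Set.Icc T₁ T₂,
        rho c / π ^ 2 * hPlus s * Real.sin (Real.log c * s / 2) ^ 2 /
          ((s - rho c * ((m : ℤ) : ℝ)) * (s - rho c * ((n : ℤ) : ℝ))) := by
  have hρ := rho_pos hc
  set ρ := rho c with hρdef
  set g : ℝ → ℝ := fun s => ρ / π ^ 2 * hPlus s * Real.sin (Real.log c * s / 2) ^ 2 /
      ((s - ρ * ((m : ℤ) : ℝ)) * (s - ρ * ((n : ℤ) : ℝ))) with hg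
  have hm := abs_rho_mul_le hc m
  have hn := abs_rho_mul_le hc n
  rw [← hρdef] at hm hn
  -- denominators do not vanish for `|s| ≥ T₁`
  have hden : ∀ s : ℝ, T₁ ≤ |s| → ∀ l : idx N,
      s - ρ * ((l : ℤ) : ℝ) ≠ 0 ∧ s + ρ * ((l : ℤ) : ℝ) ≠ 0 := by
    intro s hs l
    have hl := abs_rho_mul_le hc l
    rw [← hρdef] at hl
    have h1 : |ρ * ((l : ℤ) : ℝ)| < |s| := by linarith
    constructor
    · intro h
      have : s = ρ * ((l : ℤ) : ℝ) := by linarith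
      rw [this] at h1; exact lt_irrefl _ h1
    · intro h
      have : s = -(ρ * ((l : ℤ) : ℝ)) := by linarith
      rw [this, abs_neg] at h1; exact lt_irrefl _ h1
  -- continuity of `g` on `{ |s| ≥ T₁ }`-sets
  have hgc : ∀ s : ℝ, T₁ ≤ |s| → ContinuousAt g s := by
    intro s hs
    have h1 := (hden s hs m).1
    have h2 := (hden s hs n).1
    simp only [hg]
    refine ContinuousAt.div ?_ (by fun_prop) (mul_ne_zero h1 h2)
    exact ((continuousAt_const.mul continuous_hPlus.continuousAt).mul (by fun_prop))
  have hgcont : ∀ a b : ℝ, T₁ ≤ a → a ≤ b → ContinuousOn g (Set.Icc a b) := fun a b ha _ =>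
    fun s hs => (hgc s (by rw [abs_of_pos (by linarith [hs.1])]; exact ha.trans hs.1)).continuousWithinAt
  have hgcont' : ∀ a b : ℝ, T₁ ≤ a → a ≤ b → ContinuousOn g (Set.Icc (-b) (-a)) := fun a b ha _ =>
    fun s hs => (hgc s (by rw [abs_of_neg (by linarith [hs.2])]; linarith [hs.2])).continuousWithinAt
  -- pointwise: the integrand is `g(T) + g(−T)` on `[T₁, T₂]`
  have hpt : ∀ T ∈ Set.uIcc T₁ T₂,
      1 / π ^ 2 * (hPlus T * Real.sin (Real.log c * T / 2) ^ 2 / ρ *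
        (pVec c N T m * pVec c N T n + qVec c N T m * qVec c N T n)) = g T + g (-T) := by
    intro T hT
    rw [Set.uIcc_of_le h12.le] at hT
    have hTabs : T₁ ≤ |T| := by rw [abs_of_pos (by linarith [hT.1])]; exact hT.1
    obtain ⟨hm1, hm2⟩ := hden T hTabs m
    obtain ⟨hn1, hn2⟩ := hden T hTabs n
    simp only [hg, pVec_eq hc, qVec_eq hc, ← hρdef, hPlus_neg]
    rw [show Real.log c * -T / 2 = -(Real.log c * T / 2) by ring, Real.sin_neg, neg_sq]
    have e1 : (-T - ρ * ((m : ℤ) : ℝ)) * (-T - ρ * ((n : ℤ) : ℝ)) =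
        (T + ρ * ((m : ℤ) : ℝ)) * (T + ρ * ((n : ℤ) : ℝ)) := by ring
    rw [e1]
    have hπ : (π : ℝ) ^ 2 ≠ 0 := by positivity
    field_simp
  -- interval integrability
  have hi1 : IntervalIntegrable g volume T₁ T₂ :=
    ((hgcont T₁ T₂ le_rfl h12.le).mono (by rw [Set.uIcc_of_le h12.le])).intervalIntegrable
  have hi2 : IntervalIntegrable (fun T => g (-T)) volume T₁ T₂ := by
    refine (ContinuousOn.intervalIntegrable ?_)
    rw [Set.uIcc_of_le h12.le]
    intro T hT
    have : T₁ ≤ |(-T)| := by rw [abs_neg, abs_of_pos (by linarith [hT.1])]; exact hT.1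
    exact ((hgc (-T) this).comp (continuous_neg.continuousAt)).continuousWithinAt
  calc (1 / π ^ 2) * ∫ T in T₁..T₂, hPlus T * Real.sin (Real.log c * T / 2) ^ 2 / ρ *
          (pVec c N T m * pVec c N T n + qVec c N T m * qVec c N T n)
      = ∫ T in T₁..T₂, (g T + g (-T)) := by
        rw [← intervalIntegral.integral_const_mul]
        exact intervalIntegral.integral_congr hpt
    _ = (∫ T in T₁..T₂, g T) + ∫ T in T₁..T₂, g (-T) := intervalIntegral.integral_add hi1 hi2
    _ = (∫ T in T₁..T₂, g T) + ∫ T in (-T₂)..(-T₁), g T := by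
        rw [intervalIntegral.integral_comp_neg]
    _ = (∫ T in Set.Icc T₁ T₂, g T) + ∫ T in Set.Icc (-T₂) (-T₁), g T := by
        rw [intervalIntegral.integral_of_le h12.le, intervalIntegral.integral_of_le (by linarith),
          integral_Icc_eq_integral_Ioc, integral_Icc_eq_integral_Ioc]
    _ = ∫ s in Set.Icc (-T₂) (-T₁) ∪ Set.Icc T₁ T₂, g s := by
        rw [add_comm]
        refine (setIntegral_union ?_ measurableSet_Icc ?_ ?_).symm
        · exact Set.disjoint_left.2 fun s hs hs' => by linarith [hs.2, hs'.1]
        · exact (hgcont' T₁ T₂ le_rfl h12.le).integrableOn_compact isCompact_Icc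
        · exact (hgcont T₁ T₂ le_rfl h12.le).integrableOn_compact isCompact_Icc

/-! ## §4. Clause 3 of [Gr26] Theorem 3.2 for the explicit rank-two density -/

/-- **[Gr26] Theorem 3.2, minors clause, for the rank-two density matrix.** For `c > 1`,
`T₂ > T₁ > max(ρN, 7)` and strictly increasing row/column index maps `r, s : Fin k → I_N`, the
minor `det [M(r_i, s_j)]` of
`M(m,n) = (1/π²)∫_{T₁}^{T₂} h₊(T) sin²(LT/2) ρ⁻¹ (p_T(m)p_T(n) + q_T(m)q_T(n)) dT` is `> 0`
(strict total positivity in the order `−N < ⋯ < N`). Combined with clause (1) of Theorem 3.2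
(the identification `Δ_{T₁,T₂} = M`, proved elsewhere) this is clause (3) as printed.
[cite: Groskin2026, Theorem 3.2 (p. 10), clause "every minor … with increasing row and column sets is strictly positive"; proof pp. 10–11] -/
theorem det_submatrix_tailDensity_pos {c : ℝ} (hc : 1 < c) (N : ℕ) {T₁ T₂ : ℝ}
    (hT₁ : max (rho c * N) 7 < T₁) (h12 : T₁ < T₂) {k : ℕ} (r s : Fin k → idx N)
    (hr : StrictMono fun i ↦ ((r i : ℤ))) (hs : StrictMono fun i ↦ ((s i : ℤ))) :
    0 < ((Matrix.of fun m n : idx N ↦ (1 / π ^ 2) * ∫ T in T₁..T₂,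
        hPlus T * Real.sin (Real.log c * T / 2) ^ 2 / rho c *
          (pVec c N T m * pVec c N T n + qVec c N T m * qVec c N T n)).submatrix r s).det := by
  have hρ := rho_pos hc
  have hN : rho c * N < T₁ := lt_of_le_of_lt (le_max_left _ _) hT₁
  have h7 : (7 : ℝ) < T₁ := lt_of_le_of_lt (le_max_right _ _) hT₁
  have h0 : (0 : ℝ) < T₁ := by linarith
  set ρ := rho c with hρdef
  set S : Set ℝ := Set.Icc (-T₂) (-T₁) ∪ Set.Icc T₁ T₂ with hSdef
  set W : ℝ → ℝ := fun x => ρ / π ^ 2 * hPlus x * Real.sin (Real.log c * x / 2) ^ 2 with hW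
  set u : Fin k → ℝ := fun t => ρ * ((r t : ℤ) : ℝ) with hu
  set v : Fin k → ℝ := fun t => ρ * ((s t : ℤ) : ℝ) with hv
  -- the minor is the Cauchy–Stieltjes matrix of §2
  have hM : (Matrix.of fun m n : idx N ↦ (1 / π ^ 2) * ∫ T in T₁..T₂,
        hPlus T * Real.sin (Real.log c * T / 2) ^ 2 / ρ *
          (pVec c N T m * pVec c N T n + qVec c N T m * qVec c N T n)).submatrix r s =
      Matrix.of fun t t' : Fin k ↦ ∫ x in S, W x / ((x - u t) * (x - v t')) := by
    ext t t'
    simp only [submatrix_apply, of_apply, hW, hu, hv, hSdef, hρdef]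
    exact tailDensity_entry_eq_setIntegral hc N hN h0 h12 (r t) (s t')
  rw [hM]
  have hS : IsCompact S := isCompact_Icc.union isCompact_Icc
  have hmemS : ∀ x ∈ S, T₁ ≤ |x| := by
    intro x hx
    rcases hx with hx | hx
    · rw [abs_of_neg (by linarith [hx.2])]; linarith [hx.2]
    · rw [abs_of_pos (by linarith [hx.1])]; exact hx.1
  have hWc : ContinuousOn W S := by
    refine Continuous.continuousOn ?_
    simp only [hW]
    exact (continuous_const.mul continuous_hPlus).mul (by fun_prop)
  have hW0 : ∀ x ∈ S, 0 ≤ W x := by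
    intro x hx
    have := hPlus_pos_of_seven_le_abs (h7.le.trans (hmemS x hx))
    simp only [hW]
    positivity
  have hus : StrictMono u := by
    intro i j hij
    simp only [hu]
    exact mul_lt_mul_of_pos_left (by exact_mod_cast hr hij) hρ
  have hvs : StrictMono v := by
    intro i j hij
    simp only [hv]
    exact mul_lt_mul_of_pos_left (by exact_mod_cast hs hij) hρ
  have hsep : ∀ x ∈ S, ∀ t t' : Fin k, 0 < (x - u t) * (x - v t') := by
    intro x hx t t'
    have h1 := abs_rho_mul_le hc (r t)
    have h2 := abs_rho_mul_le hc (s t')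
    rw [← hρdef] at h1 h2
    have h1' := abs_lt.1 (lt_of_le_of_lt h1 hN)
    have h2' := abs_lt.1 (lt_of_le_of_lt h2 hN)
    simp only [hu, hv]
    rcases hx with hx | hx
    · exact mul_pos_of_neg_of_neg (by linarith [hx.2, h1'.1]) (by linarith [hx.2, h2'.1])
    · have hx1 := hx.1
      exact mul_pos (by linarith [h1'.2]) (by linarith [h2'.2])
  -- an interval inside `(T₁, T₂)` free of zeros of `sin(L·/2)`
  obtain ⟨α, β, hαβ, hJ, hWJ⟩ : ∃ α β : ℝ, α < β ∧ Set.Icc α β ⊆ S ∧ ∀ x ∈ Set.Icc α β, 0 < W x := by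
    set n : ℤ := ⌊T₁ / ρ⌋ with hn
    set P : ℝ := min T₂ ((n + 1) * ρ) with hP
    have hP1 : T₁ < P := by
      refine lt_min h12 ?_
      have : T₁ / ρ < n + 1 := Int.lt_floor_add_one _
      rwa [div_lt_iff₀ hρ] at this
    refine ⟨(2 * T₁ + P) / 3, (T₁ + 2 * P) / 3, by linarith, ?_, ?_⟩
    · intro x hx
      right
      exact ⟨by linarith [hx.1], by linarith [hx.2, min_le_left T₂ ((n + 1) * ρ)]⟩
    · intro x hx
      have hx1 : T₁ < x := by linarith [hx.1]
      have hx2 : x < (n + 1) * ρ := by linarith [hx.2, min_le_right T₂ ((n + 1) * ρ)]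
      have hh : 0 < hPlus x := hPlus_pos_of_seven_le (by linarith)
      -- `sin(Lx/2) = sin(π x/ρ) ≠ 0` since `x/ρ ∈ (n, n+1)`
      have hlo : (n : ℝ) < x / ρ := by
        have : (n : ℝ) ≤ T₁ / ρ := Int.floor_le _
        exact this.trans_lt (div_lt_div_of_pos_right hx1 hρ)
      have hhi : x / ρ < n + 1 := by rwa [div_lt_iff₀ hρ]
      have hsin : Real.sin (Real.log c * x / 2) ≠ 0 := by
        rw [log_mul_div_two_eq hc, ← hρdef,
          show π * x / ρ = π * (x / ρ - n) + n * π by ring, Real.sin_add_int_mul_pi]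
        refine mul_ne_zero (zpow_ne_zero _ (by norm_num)) (Real.sin_pos_of_pos_of_lt_pi ?_ ?_).ne'
        · have : 0 < x / ρ - n := by linarith
          positivity
        · have : x / ρ - n < 1 := by linarith
          nlinarith [Real.pi_pos]
      simp only [hW]
      have : 0 < Real.sin (Real.log c * x / 2) ^ 2 := by positivity
      positivity
  exact det_setIntegral_cauchyKernel_pos hS hWc hW0 u v hus hvs hsep hαβ hJ hWJ

/-! ## §5. Glue: Theorem 3.2 from its clauses (1)–(2) -/

/-- **Assembly of [Gr26] Theorem 3.2 from clauses (1) and (2).** Given the rank-two density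
representation of `Δ_{T₁,T₂} = Q_arch,T₂ − Q_arch,T₁` (clause (1)) and its positive definiteness
(clause (2)) — both being proved free-standing elsewhere in the tree — the minors clause (3) follows
from `det_submatrix_tailDensity_pos`, whence the typed claim `theorem_3_2`. (A conditional theorem:
it discharges nothing by itself.) [cite: Groskin2026, Theorem 3.2 (p. 10)] -/
theorem theorem_3_2_of_repr_of_posDef
    (h1 : ∀ (c : ℝ), 1 < c → ∀ (N : ℕ) (T₁ T₂ : ℝ), max (rho c * N) 7 < T₁ → T₁ < T₂ →
      ∀ m n : idx N, (archMatrix c N T₂ - archMatrix c N T₁) m n =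
        (1 / π ^ 2) * ∫ T in T₁..T₂, hPlus T * Real.sin (Real.log c * T / 2) ^ 2 / rho c *
          (pVec c N T m * pVec c N T n + qVec c N T m * qVec c N T n))
    (h2 : ∀ (c : ℝ), 1 < c → ∀ (N : ℕ) (T₁ T₂ : ℝ), max (rho c * N) 7 < T₁ → T₁ < T₂ →
      (archMatrix c N T₂ - archMatrix c N T₁).PosDef) :
    theorem_3_2 := by
  intro c hc N T₁ T₂ hT₁ h12
  refine ⟨h1 c hc N T₁ T₂ hT₁ h12, h2 c hc N T₁ T₂ hT₁ h12, fun k r s hr hs _ ↦ ?_⟩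
  have hΔ : archMatrix c N T₂ - archMatrix c N T₁ =
      Matrix.of fun m n : idx N ↦ (1 / π ^ 2) * ∫ T in T₁..T₂,
        hPlus T * Real.sin (Real.log c * T / 2) ^ 2 / rho c *
          (pVec c N T m * pVec c N T n + qVec c N T m * qVec c N T n) := by
    ext m n
    rw [Matrix.of_apply]
    exact h1 c hc N T₁ T₂ hT₁ h12 m n
  rw [hΔ]
  exact det_submatrix_tailDensity_pos hc N hT₁ h12 r s hr hs

/-! ## §6. Clause (2) from clause (3): positive definiteness via Sylvester's criterion -/

/-- A real symmetric matrix indexed by `I_N` all of whose minors with strictly increasing (equal) row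
and column index maps are positive is positive definite — Sylvester's criterion (the tree's
`Literature.LinearAlgebra.Matrix.posDef_of_leadingMinors_pos`, Horn–Johnson Thm 7.2.5 (b)) after
re-indexing `I_N` increasingly by `Fin (2N+1)` (`Finset.orderIsoOfFin`). This is how clause (3) of
[Gr26] Theorem 3.2 yields clause (2) on the real space. [cite: Groskin2026, Theorem 3.2 (p. 10)] -/
theorem posDef_of_det_submatrix_pos {N : ℕ} {Δ : Matrix (idx N) (idx N) ℝ} (hH : Δ.IsHermitian)
    (hmin : ∀ (k : ℕ) (r : Fin k → idx N), StrictMono (fun i ↦ ((r i : ℤ))) →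
      0 < (Δ.submatrix r r).det) :
    Δ.PosDef := by
  classical
  set e : Fin (idx N).card ≃o idx N := (idx N).orderIsoOfFin rfl with he
  have hB : (Δ.submatrix e e).PosDef := by
    refine posDef_of_leadingMinors_pos (𝕜 := ℝ) (hH.submatrix _) fun k hk ↦ ?_
    rw [Matrix.submatrix_submatrix]
    refine hmin k _ fun i j hij ↦ ?_
    have h : e (Fin.castLE hk i) < e (Fin.castLE hk j) :=
      e.strictMono (Fin.strictMono_castLE hk hij)
    exact Subtype.coe_lt_coe.2 h
  have hΔ : Δ = (Δ.submatrix e e).submatrix e.symm e.symm := by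
    ext i j
    simp
  rw [hΔ]
  exact hB.submatrix e.symm.injective

/-- **[Gr26] Theorem 3.2 from its clause (1) alone.** Given the rank-two density representation of
`Δ_{T₁,T₂} = Q_arch,T₂ − Q_arch,T₁` (clause (1), ∀-closed exactly as typed in `theorem_3_2`), clause (3)
is `det_submatrix_tailDensity_pos` and clause (2) follows from clause (3) by
`posDef_of_det_submatrix_pos` (the density is symmetric in `(m, n)`), whence the typed claim
`theorem_3_2`. (Conditional theorem; discharges nothing by itself — the discharge
`theorem_3_2_holds` is `theorem_3_2_of_repr c1` once clause (1) is a tree theorem.)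
[cite: Groskin2026, Theorem 3.2 (p. 10)] -/
theorem theorem_3_2_of_repr
    (h1 : ∀ (c : ℝ), 1 < c → ∀ (N : ℕ) (T₁ T₂ : ℝ), max (rho c * N) 7 < T₁ → T₁ < T₂ →
      ∀ m n : idx N, (archMatrix c N T₂ - archMatrix c N T₁) m n =
        (1 / π ^ 2) * ∫ T in T₁..T₂, hPlus T * Real.sin (Real.log c * T / 2) ^ 2 / rho c *
          (pVec c N T m * pVec c N T n + qVec c N T m * qVec c N T n)) :
    theorem_3_2 := by
  refine theorem_3_2_of_repr_of_posDef h1 fun c hc N T₁ T₂ hT₁ h12 ↦ ?_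
  have hΔ : archMatrix c N T₂ - archMatrix c N T₁ =
      Matrix.of fun m n : idx N ↦ (1 / π ^ 2) * ∫ T in T₁..T₂,
        hPlus T * Real.sin (Real.log c * T / 2) ^ 2 / rho c *
          (pVec c N T m * pVec c N T n + qVec c N T m * qVec c N T n) := by
    ext m n
    rw [Matrix.of_apply]
    exact h1 c hc N T₁ T₂ hT₁ h12 m n
  refine posDef_of_det_submatrix_pos ?_ fun k r hr ↦ ?_
  · rw [hΔ]
    ext m n
    simp only [Matrix.conjTranspose_apply, Matrix.of_apply, star_trivial]
    congr 1
    refine intervalIntegral.integral_congr fun T _ ↦ ?_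
    ring
  · rw [hΔ]
    exact det_submatrix_tailDensity_pos hc N hT₁ h12 r r hr hr

end Literature.NumberTheory.LFunctions.Groskin2026

end
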